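import Mathlib.GroupTheory.SpecificGroups.Dihedral
import Mathlib.GroupTheory.PGroup
import HarnessLib

/-!
# A homomorphism out of `D_{2n}` (`n` odd) whose kernel is an `ℓ`-group, `ℓ ∤ n`, is injective
# (Khare–Wintenberger (I), proof of Lemma 6.3 (ii): reduction is bijective on `D_{2t^a}`)

Topic `Literature/NumberTheory/GaloisRepresentations`; theorems only (no definitions, no named
facts).  Khare–Wintenberger, *Serre's modularity conjecture (I)*, Invent. Math. 178 (2009),
proof of Lemma 6.3 (ii):

> Part (ii) follows from strict compatibility, part (i) and the following observation. Let
> `a ≥ 1` be an integer, let `t ≠ 2` and `r` be distinct primes. Let `D_{2t^a} ⊂ PGL₂(ℚ̄_r)`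
> be the dihedral group of order `2t^a` which we may assume to be a subgroup of `PGL₂(O)` with
> `O` the valuation ring of `ℚ̄_r`. Then the reduction map is bijective on `D_{2t^a}`.

The kernel of the reduction map `PGL₂(O) → PGL₂(𝔽̄_r)` meets a finite subgroup in an
`r`-group; granted that (the `r`-adic input, not treated here), the observation is the
following piece of group theory, proved in this file:

* `DihedralGroup.injective_of_isPGroup_ker` — for `n` odd, `n > 1`, a prime `ℓ ∤ n` and a
  homomorphism `f : D_{2n} → P` whose kernel is an `ℓ`-group, `f` is injective.  (Rotations
  have order dividing `n`, prime to `ℓ`, so a rotation in the kernel is trivial; a reflection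
  `s` in the normal subgroup `ker f` would put the conjugate reflection `r s r⁻¹` and the product
  of the two, the rotation `r(-2) ≠ 1` (`n` odd `> 1`), in the kernel.)  For `n = t^a`,
  `ℓ = r ≠ t`, `t` odd, this is the observation as printed.
* `DihedralGroup.orderOf_r_dvd` — `ord(r i) ∣ n`.

## References

* [KhareWintenberger2009] C. Khare, J.-P. Wintenberger, *Serre's modularity conjecture (I)*,
  Invent. Math. 178 (2009), §6, proof of Lemma 6.3 (ii).
-/

namespace DihedralGroup

/-- The rotation `r i ∈ D_{2n}` has order dividing `n` (`r i = (r 1)^i` and `ord(r 1) = n`).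
[folklore] -/
theorem orderOf_r_dvd {n : ℕ} [NeZero n] (i : ZMod n) : orderOf (r i) ∣ n := by
  have h : r i = (r 1 : DihedralGroup n) ^ i.val := by
    rw [r_one_pow, ZMod.natCast_zmod_val]
  rw [h]
  exact (orderOf_pow_dvd _).trans (by rw [orderOf_r_one])

/-- **A homomorphism out of `D_{2n}`, `n` odd `> 1`, whose kernel is an `ℓ`-group for a prime
`ℓ ∤ n`, is injective** — the group theory of "the reduction map is bijective on `D_{2t^a}`"
(`n = t^a`, `ℓ = r ≠ t`, `t` odd). [cite: KhareWintenberger2009, §6, proof of Lemma 6.3 (ii)] -/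
theorem injective_of_isPGroup_ker {n : ℕ} (hn : Odd n) (h1 : 1 < n) {P : Type*} [Group P]
    (f : DihedralGroup n →* P) {ℓ : ℕ} (hℓ : ℓ.Prime) (hℓn : ¬ ℓ ∣ n)
    (hker : IsPGroup ℓ f.ker) : Function.Injective f := by
  haveI : NeZero n := ⟨by omega⟩
  have hcop : ∀ k : ℕ, (ℓ ^ k).Coprime n := fun k =>
    Nat.Coprime.pow_left k ((Nat.Prime.coprime_iff_not_dvd hℓ).mpr hℓn)
  -- a rotation in the kernel is trivial
  have hrot : ∀ i : ZMod n, f (r i) = 1 → r i = 1 := by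
    intro i hi
    obtain ⟨k, hk⟩ := hker ⟨r i, hi⟩
    have hik : (r i : DihedralGroup n) ^ ℓ ^ k = 1 := by
      have := congrArg Subtype.val hk
      simpa using this
    have h2 : orderOf (r i) ∣ ℓ ^ k := orderOf_dvd_of_pow_eq_one hik
    have h3 : orderOf (r i) = 1 :=
      (Nat.Coprime.coprime_dvd_left h2 (hcop k)).eq_one_of_dvd (orderOf_r_dvd i)
    exact orderOf_eq_one_iff.mp h3
  rw [injective_iff_map_eq_one]
  intro x hx
  cases x with
  | r i => exact hrot i hx
  | sr i =>
    exfalso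
    -- the conjugate reflection `r 1 · sr i · (r 1)⁻¹ = sr (i - 2)` and the rotation
    -- `sr i · sr (i - 2) = r (-2)` lie in the kernel
    have hconj : f (sr (i - 2)) = 1 := by
      have h3 : (sr (i - 2) : DihedralGroup n) = r 1 * sr i * (r 1)⁻¹ := by
        rw [r_mul_sr, inv_r, sr_mul_r]
        congr 1
        ring
      rw [h3, map_mul, map_mul, hx, mul_one, ← map_mul, mul_inv_cancel, map_one]
    have hprod : f (r (-2)) = 1 := by
      have h3 : (r (-2) : DihedralGroup n) = sr i * sr (i - 2) := by
        rw [sr_mul_sr]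
        congr 1
        ring
      rw [h3, map_mul, hx, hconj, one_mul]
    -- so `r (-2) = 1`, i.e. `n ∣ 2`: impossible for `n` odd `> 1`
    have h4 : (r (-2) : DihedralGroup n) = 1 := hrot _ hprod
    rw [one_def] at h4
    have h5 : ((2 : ℕ) : ZMod n) = 0 := by
      have h6 : (-2 : ZMod n) = 0 := r.inj h4
      have h7 : (2 : ZMod n) = 0 := by simpa using congrArg Neg.neg h6
      exact_mod_cast h7
    rw [ZMod.natCast_eq_zero_iff] at h5
    have h8 : n ≤ 2 := Nat.le_of_dvd (by norm_num) h5
    obtain ⟨m, hm⟩ := hn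
    omega

end DihedralGroup
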